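import Literature.NumberTheory.Weil1965.SiegelWeilBorelBound
import Literature.NumberTheory.Automorphic.DoubledUnitaryRankOneReductionDiag
import HarnessLib

/-!
# Crux H413, E-2 child line `F0_E2SiegelWeilWeilRange`, row SW2c-BOUND: the normalised Borel bound (**)′ ASSEMBLED
# from Weil's Lemme 20 (★ reduction theory of the rank-one doubled unitary group) and ★ `exists_borelBound`

HC_CM is proved only modulo the printed citations until rung 0 closes; nothing in this file is about HC.  Cell `hodgecm-mathlib`,
floor 0, programme P4, engine E-2, item stmt-HodgeConjecture-24833 (`--supports`); seat F0P4-p07 (g3); sheet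
`F0/P4/SW2c-BOUND-ASSEMBLY` (v0 80ee9fe8, finding `SW2c-BOUND-FINDING-REDB.v0` 40b1d259: the rational Weyl flip of «RED-B» leaves the
unipotent parameter `x/N(u)` unbounded on the wide ray, so the assembly is Weil's Lemme 20 AS PRINTED, with a compact `C ⊆ U(W□)(𝔸)`).

THE MATHEMATICS ([Weil1965] n° 47 Lemme 20 and n° 50, proof of Thm. 4): let `E` be a linear functional on `𝒮(𝔸_F^m)` (the
difference `I□ − κ·eis` of the doubled theta integral and the Siegel–Eisenstein functional, in the δ♮-frame), `Φ ∈ 𝒮`, and let the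
`W`-member `U_D = U(T_W ⊕ −T_W)(𝔸_F)` of the doubled dual pair act on `𝕎_𝔸` through a homomorphism `j : U_D → Sp(𝕎_𝔸)`
(the δ♮-conjugate of the pair embedding `ι(1 ⊗ ·)`; abstract here).  Suppose
* (INV)  every RATIONAL `γ ∈ U_D(F)` has an `L²`-isometric lift `r ∈ Mp` over `j γ` with `E ∘ ω(r⁻¹) = E`
  (Weil's `r_F`, ★ `l2Scaling_ratThetaLiftCont`, and the invariance of `I□` and `eis` under `IW(F)`);
* (RAY)  the real ray `d(z_E r) = M·diag(z_E r, (z_E r)⁻¹)·M⁻¹` (`M` the Cayley matrix of ★ `DoubledUnitaryRankOneReductionDiag`),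
  `r ≥ 1`, has a lift acting by the DILATION `Φ ↦ Φ(r ·)` — `ω(g) = twistLM (posRealScalar m F r)` (the frame letter (L-D) on the
  real ray: `d(u)` acts by `Φ♮(ū·x)`; this is the CONTRACTING = narrow side, modulus `L = r^{−m[F:ℚ]} ≤ 1`);
* (DOM-C)+(NARROW) for EVERY compact `C ⊆ U_D(𝔸)`: implementers `q_c ∈ Mp` over `j c` (`c ∈ C`) with moduli `≥ c₁ > 0`, and the
  NARROW-RAY BOUND `‖E(ω(z(ρ)⁻¹)(ω q_c Φ))‖ ≤ M_B · ρ^{m[F:ℚ]/2}` for `ρ ≤ 1`, uniformly in `c ∈ C` — the conclusion of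
  ★ `SiegelWeilNarrowRayBound.exists_narrowRay_bound` (or its dominated form) for the family `{ω(q_c)Φ : c ∈ C}` at `β = 0`, `a = 1`
  («uniformément en `Φ` sur toute partie compacte», Weil's Lemme 5 for the `W□`-member).
Then (**)′ holds on the WHOLE Borel: `∃ M, ∀ p ∈ Mp` lying over `j(b)`, `b ∈ U_D` stabilising `W^Δ` (`b₀₀ + b₀₁ = b₁₀ + b₁₁`),
`‖E(ω(p)Φ)‖ ≤ M · L(p)^{1/2}` — LIFT-FREE (every lift of every Borel element), so that the frame letters (L-N)/(L-D) and the
coefficient extraction (COEFF-b) consume it unchanged.  PROOF = ★ `DoubledUnitary.RankOneReduction.exists_borel_reduction_diag`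
(A-p16 (g18): `∀ b` Borel `∃ γ` rational `∃ r ≥ 1`, `d(z_E r)⁻¹·γ·b ∈ C`, `C` compact — Weil's Lemme 20 datum, threshold `r₁ := 1`)
fed as the reduction hypothesis `hred` of ★ `Weil1964.exists_borelBound` (F0P4-p07 (g2)) with `R :=` the isometric `E`-invariant
elements, `G :=` the ray lifts (coordinates `β = 0`, `a = 1`, `ρ = 1/r`), `Q := q(C)`; the modulus of the ray point is computed inside
`exists_borelBound` (`l2Scaling_of_omega_eq_borelTranslate`).  No analysis and no group theory is proved here.

References: A. Weil, *Sur la formule de Siegel dans la théorie des groupes classiques*, Acta Math. 113 (1965), n° 47 Lemme 20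
(p. 67), n° 50 (proof of Thm. 4) [Weil1965]; A. Weil, *Sur certains groupes d'opérateurs unitaires*, Acta Math. 111 (1964),
Chap. I n° 13, Chap. III n° 40–41 [Weil1964]; A. Borel, Publ. Math. IHÉS 16 (1963), §5 Thm. 5.8 [Borel1963].
-/

set_option autoImplicit false

noncomputable section

set_option linter.dupNamespace false

namespace Summit.HodgeConjecture.HodgeConjecture.Cruxes.H413.E2SWBorelBound

open scoped NNReal ENNReal Matrix
open _root_.MeasureTheory NumberField Matrix
open Literature.RepresentationTheory.HeisenbergGroup
open Literature.NumberTheory.Weil1964 Literature.NumberTheory.Automorphic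
open Literature.NumberTheory.Automorphic.DoubledUnitary.RankOneReduction

variable (F E : Type) [Field F] [NumberField F] [Field E] [NumberField E] [Algebra F E] (c : E ≃ₐ[F] E)
  (TW : Matrix (Fin 1) (Fin 1) F)

/-- The good-set coordinates of the assembly (`S = 0`, `A = {1}`): `chirp(β • 0) ∘ twist(a · g) = twist(g)` on `𝒮(𝔸_F^m)` for `a ∈ {1}`
(stated with the membership hypothesis so that no substitution happens in the large context of the main proof). [folklore] -/
theorem chirpLM_smul_zero_twistLM_mul_of_mem_singleton {m : ℕ} (β : AdeleRing (𝓞 F) F)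
    {a : GL (Fin m) (AdeleRing (𝓞 F) F)} (ha : a ∈ ({1} : Set (GL (Fin m) (AdeleRing (𝓞 F) F))))
    (g : GL (Fin m) (AdeleRing (𝓞 F) F)) (Ψ : piSchwartzBruhat F (Fin m)) :
    chirpLM F (β • (0 : Matrix (Fin m) (Fin m) (AdeleRing (𝓞 F) F))) (twistLM F (a * g) Ψ) = twistLM F g Ψ := by
  rw [Set.mem_singleton_iff.1 ha, smul_zero, chirpLM_zero, one_mul, Module.End.one_apply]

set_option maxHeartbeats 400000 in
/-- **THE NORMALISED BOREL BOUND (**)′ ON THE WHOLE BOREL OF `U(W ⊕ W⁻)(𝔸)`, from Weil's Lemme 20.**  See the module docstring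
for the hypotheses (INV), (RAY), (DOM-C)+(NARROW); the reduction datum is ★ `exists_borel_reduction_diag` and the assembly is
★ `exists_borelBound`.  Conclusion: one constant `M` with `‖E(ω(p)Φ)‖ ≤ M · √L(p)` for EVERY `p ∈ Mp_ψ(𝕎_𝔸)ᶜᵒⁿᵗ` lying over the
`j`-image of a Borel element of `U_D = U(T_W ⊕ −T_W)(𝔸_F)`. [cite: Weil1965, n° 47 Lemme 20 (p. 67) and n° 50] -/
theorem exists_borelBound_of_lemma20 [IsGalois F E] (h2 : ∀ σ : E ≃ₐ[F] E, σ = 1 ∨ σ = c) (δ : Eˣ)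
    (hcδ : c (δ : E) = -(δ : E)) (hTW : TW 0 0 ≠ 0)
    -- the metaplectic side: any Gram matrix `T` (for the child line: `T = doubledGramFin F (adelicGram F e T_V T_W)`, `m = n + n`)
    {m : ℕ} (T : Matrix (Fin m) (Fin m) (AdeleRing (𝓞 F) F)) (hT : IsUnit T.det)
    [MeasurableSpace (AdeleRing (𝓞 F) F)] [BorelSpace (AdeleRing (𝓞 F) F)]
    (ν : Measure (Fin m → AdeleRing (𝓞 F) F)) [ν.IsAddHaarMeasure]
    (E'' : piSchwartzBruhat F (Fin m) →ₗ[ℂ] ℂ) (Φ : piSchwartzBruhat F (Fin m))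
    -- the `W□`-member read in `Sp(𝕎_𝔸)` (abstract homomorphism; the cell instantiates `conj(δ♮) ∘ toSp(eD) ∘ adelicInr`)
    (j : ↥(UnitaryGroup.adelic F E c (1 + 1)
        ((Matrix.reindex finSumFinEquiv finSumFinEquiv (Matrix.fromBlocks TW 0 0 (-TW))).map (algebraMap F E))) →*
      ↥(symplecticGroup (polar (adelicForm F (Fin m) T))))
    -- (INV): rational elements have isometric `E''`-invariant lifts
    (hINV : ∀ (γ : GL (Fin (1 + 1)) (AdeleRing (𝓞 E) E))
      (hγ : γ ∈ UnitaryGroup.adelic F E c (1 + 1)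
        ((Matrix.reindex finSumFinEquiv finSumFinEquiv (Matrix.fromBlocks TW 0 0 (-TW))).map (algebraMap F E))),
      γ ∈ (Matrix.GeneralLinearGroup.map (algebraMap E (AdeleRing (𝓞 E) E))).range →
      ∃ r : adelicMpCont F (Fin m) T, adelicMpCont.proj F (Fin m) T r = j ⟨γ, hγ⟩ ∧
        adelicMpCont.l2Scaling F T hT ν r = 1 ∧ E'' ∘ₗ adelicMpCont.omega F (Fin m) T r⁻¹ = E'')
    -- (RAY): the real ray `M·diag(z_E r, (z_E r)⁻¹)·M⁻¹`, `r ≥ 1`, lifts to the dilation `Φ ↦ Φ(r ·)` (frame letter (L-D))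
    (hRAY : ∀ (M : GL (Fin 2) (AdeleRing (𝓞 E) E))
      (hM : (M : Matrix (Fin 2) (Fin 2) (AdeleRing (𝓞 E) E)) =
        !![1, algebraMap E (AdeleRing (𝓞 E) E) (algebraMap F E (2 * TW 0 0)⁻¹);
          1, -algebraMap E (AdeleRing (𝓞 E) E) (algebraMap F E (2 * TW 0 0)⁻¹)])
      (r : ℝ≥0ˣ), 1 ≤ (r : ℝ≥0) →
      ∃ g : adelicMpCont F (Fin m) T,
        adelicMpCont.proj F (Fin m) T g =
          j ⟨M * glDiagonal 2 (AdeleRing (𝓞 E) E) ![posRealIdele E r, (posRealIdele E r)⁻¹] * M⁻¹,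
            cayley_conj_diag_posRealIdele_mem_adelic F E c TW hTW hM r⟩ ∧
        ∀ Ψ : piSchwartzBruhat F (Fin m), adelicMpCont.omega F (Fin m) T g Ψ = twistLM F (posRealScalar m F r) Ψ)
    -- (DOM-C) + (NARROW): for every compact `C ⊆ U_D(𝔸)`, implementers with moduli `≥ c₁ > 0` and the narrow-ray bound on `{ω(q_c)Φ}`
    (hDOM : ∀ C : Set (GL (Fin (1 + 1)) (AdeleRing (𝓞 E) E)), IsCompact C →
      ∀ hCU : C ⊆ UnitaryGroup.adelic F E c (1 + 1)
        ((Matrix.reindex finSumFinEquiv finSumFinEquiv (Matrix.fromBlocks TW 0 0 (-TW))).map (algebraMap F E)),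
      ∃ q : GL (Fin (1 + 1)) (AdeleRing (𝓞 E) E) → adelicMpCont F (Fin m) T,
        (∀ (k : GL (Fin (1 + 1)) (AdeleRing (𝓞 E) E)) (hk : k ∈ C), adelicMpCont.proj F (Fin m) T (q k) = j ⟨k, hCU hk⟩) ∧
        (∃ c₁ : ℝ, 0 < c₁ ∧ ∀ k ∈ C, c₁ ≤ (adelicMpCont.l2Scaling F T hT ν (q k)).toReal) ∧
        ∃ MB : ℝ≥0∞, MB ≠ ⊤ ∧ ∀ ρ : ℝ≥0ˣ, (ρ : ℝ≥0) ≤ 1 → ∀ k ∈ C,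
          (‖E'' (twistLM F (posRealScalar m F ρ)⁻¹ (adelicMpCont.omega F (Fin m) T (q k) Φ))‖ₑ : ℝ≥0∞) ≤
            MB * ENNReal.ofReal (((ρ : ℝ≥0) : ℝ) ^ ((m : ℝ) * Module.finrank ℚ F / 2))) :
    ∃ Mbound : ℝ, ∀ (p : adelicMpCont F (Fin m) T) (b : GL (Fin (1 + 1)) (AdeleRing (𝓞 E) E))
      (hb : b ∈ UnitaryGroup.adelic F E c (1 + 1)
        ((Matrix.reindex finSumFinEquiv finSumFinEquiv (Matrix.fromBlocks TW 0 0 (-TW))).map (algebraMap F E))),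
      (b : Matrix (Fin (1 + 1)) (Fin (1 + 1)) (AdeleRing (𝓞 E) E)) 0 0 + (b : Matrix (Fin (1 + 1)) (Fin (1 + 1)) (AdeleRing (𝓞 E) E)) 0 1 =
        (b : Matrix (Fin (1 + 1)) (Fin (1 + 1)) (AdeleRing (𝓞 E) E)) 1 0 + (b : Matrix (Fin (1 + 1)) (Fin (1 + 1)) (AdeleRing (𝓞 E) E)) 1 1 →
      adelicMpCont.proj F (Fin m) T p = j ⟨b, hb⟩ →
      ‖E'' (adelicMpCont.omega F (Fin m) T p Φ)‖ ≤ Mbound * Real.sqrt (adelicMpCont.l2Scaling F T hT ν p).toReal := by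
  classical
  -- Weil's Lemme 20 datum (★ A-p16): Cayley matrix `M`, compact `C ⊆ U_D`, reduction `d(z_E r)⁻¹ γ b ∈ C`, `r ≥ 1`
  have hred0 := exists_borel_reduction_diag F E c TW h2 δ hcδ hTW 1
  obtain ⟨M, -, hM, C, hCc, hCU, hred⟩ := hred0
  -- implementers of the compact part and the narrow-ray bound on the family `{ω(q_k)Φ : k ∈ C}`
  have hD := hDOM C hCc hCU
  obtain ⟨q, hqproj, hqL', hMB'⟩ := hD
  obtain ⟨c₁, hc₁, hqL⟩ := hqL'
  obtain ⟨MB, hMB, hNarrow⟩ := hMB'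
  -- the ray lifts (for every `r ≥ 1`) and the Skolem coordinate `ρ = 1/r` of the good set (`β = 0`, `a = 1`)
  have hray := fun (r : ℝ≥0ˣ) (hr : 1 ≤ (r : ℝ≥0)) => hRAY M hM r hr
  let ρc : adelicMpCont F (Fin m) T → ℝ≥0ˣ := fun g =>
    if h : (∃ r : ℝ≥0ˣ, 1 ≤ (r : ℝ≥0) ∧ ∀ Ψ : piSchwartzBruhat F (Fin m),
      adelicMpCont.omega F (Fin m) T g Ψ = twistLM F (posRealScalar m F r) Ψ) then (Classical.choose h)⁻¹ else 1
  have hρc_spec : ∀ g : adelicMpCont F (Fin m) T, ∀ hg : (∃ r : ℝ≥0ˣ, 1 ≤ (r : ℝ≥0) ∧ ∀ Ψ : piSchwartzBruhat F (Fin m),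
      adelicMpCont.omega F (Fin m) T g Ψ = twistLM F (posRealScalar m F r) Ψ),
      1 ≤ ((ρc g)⁻¹ : ℝ≥0ˣ).val ∧ ∀ Ψ : piSchwartzBruhat F (Fin m),
        adelicMpCont.omega F (Fin m) T g Ψ = twistLM F (posRealScalar m F (ρc g)⁻¹) Ψ := by
    intro g hg
    have h := Classical.choose_spec hg
    simp only [ρc, dif_pos hg, inv_inv]
    exact h
  -- ★ `exists_borelBound` with `P` = lifts of the Borel, `R` = isometric `E''`-invariant elements, `G` = ray lifts, `Q = q(C)`
  -- (applied in stages: the one-shot application with named arguments does not elaborate within the heartbeat budget)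
  have key := exists_borelBound F T hT ν (0 : Matrix (Fin m) (Fin m) (AdeleRing (𝓞 F) F)) E'' Φ
    {p | ∃ (b : GL (Fin (1 + 1)) (AdeleRing (𝓞 E) E)) (hb : b ∈ UnitaryGroup.adelic F E c (1 + 1)
      ((Matrix.reindex finSumFinEquiv finSumFinEquiv (Matrix.fromBlocks TW 0 0 (-TW))).map (algebraMap F E))),
      (b : Matrix (Fin (1 + 1)) (Fin (1 + 1)) (AdeleRing (𝓞 E) E)) 0 0 + (b : Matrix (Fin (1 + 1)) (Fin (1 + 1)) (AdeleRing (𝓞 E) E)) 0 1 =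
        (b : Matrix (Fin (1 + 1)) (Fin (1 + 1)) (AdeleRing (𝓞 E) E)) 1 0 + (b : Matrix (Fin (1 + 1)) (Fin (1 + 1)) (AdeleRing (𝓞 E) E)) 1 1 ∧
      adelicMpCont.proj F (Fin m) T p = j ⟨b, hb⟩}
    {g | ∃ r : ℝ≥0ˣ, 1 ≤ (r : ℝ≥0) ∧ ∀ Ψ : piSchwartzBruhat F (Fin m),
      adelicMpCont.omega F (Fin m) T g Ψ = twistLM F (posRealScalar m F r) Ψ}
    {r | adelicMpCont.l2Scaling F T hT ν r = 1 ∧ E'' ∘ₗ adelicMpCont.omega F (Fin m) T r⁻¹ = E''}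
    (q '' C) (fun r hr => hr.2) (fun r hr => hr.1) hc₁
  have key2 := key
    (by
      rintro _ ⟨k, hk, rfl⟩
      exact hqL k hk)
    (by
      -- the reduction: `p` over `j b`, `b = γ⁻¹ · d(z_E r) · k` ⇒ `π(g⁻¹ · r̃ · p) = π(q k)`
      rintro p ⟨b, hb, hrow, hpb⟩
      -- (`have` before `obtain`: destructuring a direct application does not elaborate within the heartbeat budget here)
      have h1 := hred b hb hrow
      obtain ⟨γ, hγU, hγrat, r, hr, hmem⟩ := h1
      have h2 := hINV γ hγU hγrat
      obtain ⟨rt, hrt_proj, hrt_L, hrt_E⟩ := h2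
      have h3 := hray r hr
      obtain ⟨g, hg_proj, hg_ω⟩ := h3
      have hd := cayley_conj_diag_posRealIdele_mem_adelic F E c TW hTW hM r
      refine ⟨rt, ⟨hrt_L, hrt_E⟩, g, ⟨r, hr, hg_ω⟩,
        q ((M * glDiagonal 2 (AdeleRing (𝓞 E) E) ![posRealIdele E r, (posRealIdele E r)⁻¹] * M⁻¹)⁻¹ * γ * b),
        ⟨_, hmem, rfl⟩, ?_⟩
      have hlhs : adelicMpCont.proj F (Fin m) T (g⁻¹ * rt * p) =
          (j ⟨M * glDiagonal 2 (AdeleRing (𝓞 E) E) ![posRealIdele E r, (posRealIdele E r)⁻¹] * M⁻¹, hd⟩)⁻¹ *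
            j ⟨γ, hγU⟩ * j ⟨b, hb⟩ := by
        simp only [map_mul, map_inv, hg_proj, hrt_proj, hpb]
      calc adelicMpCont.proj F (Fin m) T (g⁻¹ * rt * p)
          = (j ⟨M * glDiagonal 2 (AdeleRing (𝓞 E) E) ![posRealIdele E r, (posRealIdele E r)⁻¹] * M⁻¹, hd⟩)⁻¹ *
              j ⟨γ, hγU⟩ * j ⟨b, hb⟩ := hlhs
        _ = j ((⟨M * glDiagonal 2 (AdeleRing (𝓞 E) E) ![posRealIdele E r, (posRealIdele E r)⁻¹] * M⁻¹, hd⟩ :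
                ↥(UnitaryGroup.adelic F E c (1 + 1)
                  ((Matrix.reindex finSumFinEquiv finSumFinEquiv (Matrix.fromBlocks TW 0 0 (-TW))).map (algebraMap F E))))⁻¹ *
              ⟨γ, hγU⟩ * ⟨b, hb⟩) := by
            simp only [map_mul, map_inv]
        _ = j ⟨(M * glDiagonal 2 (AdeleRing (𝓞 E) E) ![posRealIdele E r, (posRealIdele E r)⁻¹] * M⁻¹)⁻¹ * γ * b, hCU hmem⟩ :=
            congrArg j (Subtype.ext rfl)
        _ = _ := (hqproj _ hmem).symm)
    ({1} : Set (GL (Fin m) (AdeleRing (𝓞 F) F))) ({0} : Set (AdeleRing (𝓞 F) F)) (fun _ => 0) (fun _ => 1) ρc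
    (fun _ _ => rfl) (fun _ _ => rfl)
  have key3 := key2
    (by
      intro g hg
      have h1 := (hρc_spec g hg).1
      -- `1 ≤ ρ⁻¹ ⇒ ρ ≤ 1`
      by_contra hlt
      have hlt' : (1 : ℝ≥0) < (ρc g : ℝ≥0) := lt_of_not_ge hlt
      have h2 : ((ρc g)⁻¹ : ℝ≥0ˣ).val < 1 := by
        rw [Units.val_inv_eq_inv_val]
        exact inv_lt_one_of_one_lt₀ hlt'
      exact absurd h1 (not_le.2 h2))
    (by
      intro g hg Ψ
      rw [← map_inv (posRealScalar m F)]
      exact ((hρc_spec g hg).2 Ψ).trans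
        (chirpLM_smul_zero_twistLM_mul_of_mem_singleton F 0 (Set.mem_singleton 1) _ Ψ).symm)
    (D₁ := 1)
    (by
      intro a ha
      obtain rfl : a = 1 := Set.mem_singleton_iff.1 ha
      exact (map_one (adelicAbsDet m F)).le)
    hMB
    (by
      intro β _ a ha ρ hρ qk hqk
      obtain ⟨k, hk, rfl⟩ := hqk
      exact (congrArg (fun Ψ : piSchwartzBruhat F (Fin m) => (‖E'' Ψ‖ₑ : ℝ≥0∞))
        (chirpLM_smul_zero_twistLM_mul_of_mem_singleton F β ha (posRealScalar m F ρ)⁻¹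
          (adelicMpCont.omega F (Fin m) T (q k) Φ))).trans_le (hNarrow ρ hρ k hk))
  obtain ⟨Mbound, hMbound⟩ := key3
  exact ⟨Mbound, fun p b hb hrow hpb => hMbound p ⟨b, hb, hrow, hpb⟩⟩

end Summit.HodgeConjecture.HodgeConjecture.Cruxes.H413.E2SWBorelBound

end
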